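import Summits.QuantumFields.QCD.Theses.SpectralDefectExtinction
import Literature.MathematicalPhysics.QuantumFieldTheory.QCDPhaseQuenchedPositivity
import Summits.QuantumFields.QCD.Theorems.SpectralDefectExtinctionWindowExtinctionCellSpreadWindowToMoment
import Summits.QuantumFields.QCD.Theorems.SpectralDefectExtinctionWindowExtinctionCellSpreadIndexMeasurable

/-!
# Line `uv-instanton-floor` — skeleton for the crux `WindowExtinction` = SD⁺ (stmt-QuantumFields-18063)

Route `SpectralDefectExtinction`; crux idea `Cruxes/WindowExtinction/Ideas/uv-instanton-floor.md` (ideator 2, round 1;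
triage r1-1 / r1-2: pass, MERGED with `variational-instanton-implant` — same lever); crux-plan seat
`planner-cruxplan-stmt-QuantumFields-18063-uv-instanton-floor-0`, 2026-08-17.  Line card: `Lines/uv-instanton-floor.md`.

## The line in one paragraph

TIGHT⁺ — `E₊|index| ≥ max 1 (η (a_k(2L_k+1))²)` with `∃ η` BEFORE `∀ M ∀ᶠ k` — is the junk-excluding content of SD⁺
(`Negative/NearTipBand`, `Negative/FloorNecessary`).  The card sources it in the ULTRAVIOLET: blocks of fixed PHYSICAL pitch
`P` (huge in lattice units) carry a dilute, semiclassical small instanton of physical size `ρ₀ ≪ 1/Λ` with CONDITIONAL odds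
`e^{−K}`, `K` independent of `k` (asymptotic freedom at the scale `ρ₀`; the lower bound is ONE transport map with bounded
conditional-mean cost — Jensen, not UV stability), and each occupied block raises the Wilson index at every probe below the
line by exactly one.  Conditioning on the FRAME (all links outside the block interiors) makes the pure-gauge law of the block
interiors an exact product (range-one plaquette action); the `∏_f |det D_W(m_f(k))|` tilt couples the blocks only
Dobrushin-weakly at physical pitch (heavy sea quarks, `M₀` free).  A high-temperature (Dobrushin) central limit theorem for
the number of occupied blocks then gives anti-concentration of the index at the CLT scale `√N_k ≍ (a_k(2L_k+1))²/P²`, i.e.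
TIGHT⁺ with `η` FIXED.  Registered stubs:

* `stub_dobrushinFibreSpread` (S1, ABSTRACT probability — the new combination theorem the triage asked for, r1-2 §uv):
  a bounded tilt `W` of a finite product probability space whose single-coordinate conditional odds of OCC : EMPTY are
  pinched in `[e^{−K}, e^{K}]` and whose mixed second differences obey a Dobrushin row condition `Σ_j c_ij ≤ 1/2` puts
  mass `≤ 1/8` on every window of the occupation number of length `≤ λ(K)·√n`, `n ≥ n₀(K)` (`FibreSpread`).
* `stub_frameReduction` (S2, ABSTRACT measure theory): a `FibreWitness` — a measurable identification of `(Ω, w·μ)` with a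
  tilted frame × blocks product on which the integer observable `X` responds to EMPTY → OCC switches by exactly `+1` off a
  switch-saturated bad set of relative mass `≤ δ`, with `≥ n₁` active blocks off mass `≤ δ`, and with the pointwise odds /
  Dobrushin bounds — transfers any fibrewise window bound `κ` to `∫_{x ≤ X < x+JD} w ∂μ ≤ J(κ + 2δ) ∫ w ∂μ`.
* `stub_pinnedCleanEdge` (S3, THE (E)-SIDE TRUNK, `∃ reg`): an admissible, capped, branched regularisation of SLOW physical
  volume growth (`a_k(2L_k+1) ≤ a_k^{−1/2}`) and PHYSICAL DEPTH (`m_crit(k) ≤ −κ₀/β_k`) with EXTINCT verbatim and TIGHT with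
  floor ONE — the body of the pre-restate crux (stmt-8964) plus cap, branch, slow growth and depth, WITHOUT the extensive
  floor R2.  Conceded to the EXTINCT-side lines (as by every TIGHT⁺-side card of this crux, triage §X(1)); its TIGHT₁ half is
  within reach of the cards' ONE-LOOP lever.
* `stub_uvFibreAmplification` (S4, THE MECHANISM, `∀ reg`): every mass-scaling, asymptotically scaling regularisation of slow
  growth and physical depth whose line is EXTINCT-clean and TIGHT₁-pinned at a tuple `m` carries, above a heavy-sea threshold
  `M₁(reg)` and with `K, c₁` chosen BEFORE the probe `M`, for every `M > M₀` eventually in `k`, a `FibreWitness` for the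
  phase-quenched measure at `(β_k, 2L_k+1, m_f(k))` and the index at probe `m_crit(k) − a_kM/Z_k`, with `δ = 1/32` and
  `n₁ ≥ c₁ (a_k(2L_k+1))⁴` active blocks — O(1) tightness is AMPLIFIED to the extensive floor by UV instantons.  Its four
  physical sub-claims (T-dom two-sided k-uniform conditional block odds = two-loop-matched transport in conditional mean;
  T-loc Dobrushin locality of the `|det|` tilt at physical pitch, heavy sea; T-resp index response = DRESS + near-probe
  sparsity + cocycle locality p104175; T-act small-field typicality) are itemised in the card.
* `WindowExtinction_of` (PROVED here from S1–S4 + the landed `stub_windowToMoment` p138628 and `stub_indexMeasurable`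
  p139854): threshold `max M₀ M₁`, `η = (13/64)·λ(K)·√c₁`.

All `sorry`s are inside the four `stub_*` theorems.  The two defs `FibreSpread`, `FibreWitness` are the line's interface
vocabulary (abstract probability; to be single-sourced — preferably under `Literature/Probability/…` as definitions, else a
`Theorems/…UVInstantonFloorDefs.lean` as for `ChessboardDefs` p98783 — before S1/S2 land verbatim).

## Disproof.lean / Negative knowledge honoured (tree copy 2026-08-17T02:24Z, cycles 1–3; no `_false_without_`, no `-- Targets`)
Finding 1 (`extinctOnly_holds`: TIGHT⁺ load-bearing) — this line is a TIGHT⁺ engine (S4 + S1 + S2), EXTINCT and the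
O(1) pin ride in S3 verbatim;
Finding 2/3 (`tight_pins_mcrit`, `window_realModes_ge`: accumulation edge) — consumed, not evaded: the occupied block's chiral
real mode sits at the dressed edge `+ c a_k²/ρ₀²`, inside every probe window `a_kM/Z_k` eventually (T-resp); Finding 5
(`not_windowExtinctionUniformM`) — S4 has `∀ M, ∀ᶠ k` and `K, c₁` before `M`, so `η` is `M`-free as TIGHT⁺ demands;
Finding 8 (`windowConstant_le_one`) — `c` untouched; Finding 10 (`p ≥ 2`) — slow growth `ℓ_k ≤ a_k^{−1/2}` is cap `p = 2`
(`L_k = ⌈a_k⁻¹ n_k⌉`); Finding 11 (probe below the line, modulus) — verbatim; Finding 13 (one-sided) — windows are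
symmetric, no cancellation budget used.  `Negative/FloorNecessary` (floor `E₊[X²] ≥ η²a_k⁴` per site NECESSARY): sourced
here by `N_k e^{−K}` occupied blocks per scheme torus, `N_k ≍ ℓ_k⁴/P⁴`.  `Negative/NearTipBand`, `VolumeLever`: the near-tip /
free-volume junk families violate S3's depth / slow-growth / TIGHT₁ clauses and admit NO fibre witness (T-resp fails:
no dressed mode inside `[0, a_kM/Z_k)`), so neither S3 nor S4 is inhabited hollowly.  Negatives index (5 QuantumFields entries): unrelated.
-/

noncomputable section

namespace Summit.QuantumFields.QCD.Cruxes.WindowExtinction.UVInstantonFloor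

open scoped BigOperators Topology Classical MeasureTheory Matrix ComplexConjugate ENNReal NNReal
open Filter MeasureTheory Matrix
open Literature.MathematicalPhysics.QuantumLattice Literature.MathematicalPhysics.QuantumFieldTheory
  Literature.Probability.LatticeModels
open Summit.QuantumFields.QCD.Theses.SpectralDefectExtinction
open Summit.QuantumFields.QCD.Cruxes.WindowExtinction.WallConditionedCellSpread
  (stub_windowToMoment stub_indexMeasurable)

/-- The colour group. -/
local notation "SU3" => Matrix.specialUnitaryGroup (Fin 3) ℂ

/-! ## §A  Interface vocabulary -/

/-- **Fibre spread at level `κ`** (the conclusion shape of S1 and the fibrewise hypothesis of S2).  For EVERY probability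
space `(F, π)`, every bounded measurable tilt `W` of the product law `π^{⊗ι}`, and every pair of disjoint measurable
cells EMPTY, OCC `⊆ F` (ACT := EMPTY ∪ OCC) such that, at every all-active point `u`,
(odds) the conditional odds OCC : EMPTY of each coordinate — ratio of the `π`-integrals of `W` over the two cells, the
other coordinates frozen — lie in `[e^{−K}, e^{K}]`, and
(Dobrushin) the mixed second differences of `log W` in two distinct coordinates are `≤ c i j` with rows `Σ_j c i j ≤ 1/2`,
EVERY window `x ≤ #occ < x + D` of the occupation number `#occ u = #{i : u i ∈ OCC}` carries `W·π^{⊗ι}`-mass at most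
`κ ×` the mass of the all-active set. -/
def FibreSpread (K : ℝ) (ι : Type) [Fintype ι] [DecidableEq ι] (D : ℕ) (κ : ℝ) : Prop :=
  ∀ (F : Type) [MeasurableSpace F] (π : Measure F) [IsProbabilityMeasure π] (W : (ι → F) → ℝ≥0∞)
    (EMPTY OCC : Set F),
    Measurable W → MeasurableSet EMPTY → MeasurableSet OCC → Disjoint EMPTY OCC →
    (∃ B : ℝ≥0, ∀ u, W u ≤ B) →
    (∀ u : ι → F, (∀ i, u i ∈ EMPTY ∪ OCC) → ∀ i,
        ENNReal.ofReal (Real.exp (-K)) * ∫⁻ v in EMPTY, W (Function.update u i v) ∂π ≤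
          ∫⁻ v in OCC, W (Function.update u i v) ∂π ∧
        ∫⁻ v in OCC, W (Function.update u i v) ∂π ≤
          ENNReal.ofReal (Real.exp K) * ∫⁻ v in EMPTY, W (Function.update u i v) ∂π) →
    (∃ c : ι → ι → ℝ≥0, (∀ i, ∑ j, (c i j : ℝ) ≤ 1 / 2) ∧
      ∀ u : ι → F, (∀ i, u i ∈ EMPTY ∪ OCC) → ∀ i j, i ≠ j →
        ∀ v ∈ EMPTY ∪ OCC, ∀ v' ∈ EMPTY ∪ OCC,
          W u * W (Function.update (Function.update u i v) j v') ≤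
            ENNReal.ofReal (Real.exp (c i j)) * (W (Function.update u i v) * W (Function.update u j v'))) →
    ∀ x : ℤ,
      ∫⁻ u in {u | (∀ i, u i ∈ EMPTY ∪ OCC) ∧
          x ≤ ((Finset.univ.filter fun i => u i ∈ OCC).card : ℤ) ∧
          ((Finset.univ.filter fun i => u i ∈ OCC).card : ℤ) < x + D}, W u ∂(Measure.pi fun _ : ι => π) ≤
        ENNReal.ofReal κ * ∫⁻ u in {u | ∀ i, u i ∈ EMPTY ∪ OCC}, W u ∂(Measure.pi fun _ : ι => π)

/-- **Fibre witness** for a weighted measure space `(Ω, w·μ)` and an integer observable `X`: a measurable identification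
`Φ : Ω ≃ E × (Fin N → F)` (frame × `N` block interiors) transporting `w·μ` to a tilt `W` of a product reference law
`ρ ⊗ π^{⊗N}`, two disjoint measurable cells EMPTY, OCC `⊆ F`, a switch-saturated bad set of relative mass `≤ δ` off which
(i) `X` goes up by exactly one when an EMPTY block is refilled from OCC and is unchanged when refilled from EMPTY,
(ii) the single-block conditional odds OCC : EMPTY lie in `[e^{−K}, e^{K}]`, (iii) the tilt's mixed second differences
across two active blocks obey a Dobrushin row condition `Σ_j c i j ≤ 1/2`; and at least `n₁` blocks are active
(in EMPTY ∪ OCC) off relative mass `≤ δ`.  On the lattice: `Ω` = gauge fields on the scheme torus, `μ` = Wilson measure,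
`w = ∏_f |det D_W(m_f(k))|`, `X` = Wilson index at the probe, `F` = links of one block, `E` = frame links, `ρ ⊗ π^{⊗N}` =
product Haar, `W = e^{−β S_W} ∏_f |det| ∘ Φ⁻¹`, OCC / EMPTY = small-field block interiors with / without one recognisable
instanton of physical size `ρ₀` and a clean local spectrum at the probe. -/
structure FibreWitness (Ω : Type) [MeasurableSpace Ω] (μ : Measure Ω) (w : Ω → ℝ) (X : Ω → ℤ)
    (K δ : ℝ) (N n₁ : ℕ) : Type 1 where
  /-- frame space -/
  E : Type
  /-- one block's interior -/
  F : Type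
  [mE : MeasurableSpace E]
  [mF : MeasurableSpace F]
  /-- reference law of the frame -/
  ρ : Measure E
  /-- reference law of one block interior -/
  π : Measure F
  [ρ_finite : IsFiniteMeasure ρ]
  [π_prob : IsProbabilityMeasure π]
  /-- frame × blocks coordinates -/
  Φ : Ω ≃ᵐ (E × (Fin N → F))
  /-- the tilt (Boltzmann factor × fermion weights in product-Haar coordinates) -/
  W : E × (Fin N → F) → ℝ≥0∞
  EMPTY : Set F
  OCC : Set F
  Bad : Set (E × (Fin N → F))
  /-- Dobrushin interaction matrix -/
  c : Fin N → Fin N → ℝ≥0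
  W_meas : Measurable W
  W_bdd : ∃ B : ℝ≥0, ∀ z, W z ≤ B
  EMPTY_meas : MeasurableSet EMPTY
  OCC_meas : MeasurableSet OCC
  disjoint : Disjoint EMPTY OCC
  EMPTY_nonempty : EMPTY.Nonempty
  Bad_meas : MeasurableSet Bad
  transport : Measure.map Φ (μ.withDensity fun ω => ENNReal.ofReal (w ω)) =
    (ρ.prod (Measure.pi fun _ : Fin N => π)).withDensity W
  saturated : ∀ z ∉ Bad, ∀ i, z.2 i ∈ EMPTY ∪ OCC → ∀ v ∈ EMPTY ∪ OCC, (z.1, Function.update z.2 i v) ∉ Bad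
  response : ∀ z ∉ Bad, ∀ i, z.2 i ∈ EMPTY →
    (∀ v ∈ OCC, X (Φ.symm (z.1, Function.update z.2 i v)) = X (Φ.symm z) + 1) ∧
    (∀ v ∈ EMPTY, X (Φ.symm (z.1, Function.update z.2 i v)) = X (Φ.symm z))
  odds : ∀ z ∉ Bad, ∀ i, z.2 i ∈ EMPTY ∪ OCC →
    ENNReal.ofReal (Real.exp (-K)) * ∫⁻ v in EMPTY, W (z.1, Function.update z.2 i v) ∂π ≤
      ∫⁻ v in OCC, W (z.1, Function.update z.2 i v) ∂π ∧
    ∫⁻ v in OCC, W (z.1, Function.update z.2 i v) ∂π ≤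
      ENNReal.ofReal (Real.exp K) * ∫⁻ v in EMPTY, W (z.1, Function.update z.2 i v) ∂π
  dobrushin_rows : ∀ i, ∑ j, (c i j : ℝ) ≤ 1 / 2
  dobrushin : ∀ z ∉ Bad, ∀ i j, i ≠ j → z.2 i ∈ EMPTY ∪ OCC → z.2 j ∈ EMPTY ∪ OCC →
    ∀ v ∈ EMPTY ∪ OCC, ∀ v' ∈ EMPTY ∪ OCC,
      W z * W (z.1, Function.update (Function.update z.2 i v) j v') ≤
        ENNReal.ofReal (Real.exp (c i j)) * (W (z.1, Function.update z.2 i v) * W (z.1, Function.update z.2 j v'))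
  bad_mass : (ρ.prod (Measure.pi fun _ : Fin N => π)).withDensity W Bad ≤
    ENNReal.ofReal δ * (ρ.prod (Measure.pi fun _ : Fin N => π)).withDensity W Set.univ
  active_mass : (ρ.prod (Measure.pi fun _ : Fin N => π)).withDensity W
      {z | (Finset.univ.filter fun i => z.2 i ∈ EMPTY ∪ OCC).card < n₁} ≤
    ENNReal.ofReal δ * (ρ.prod (Measure.pi fun _ : Fin N => π)).withDensity W Set.univ

attribute [instance] FibreWitness.mE FibreWitness.mF FibreWitness.ρ_finite FibreWitness.π_prob

/-! ## §B  Registered stubs -/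

/-- **S1 · `stub_dobrushinFibreSpread` — high-temperature anti-concentration at the CLT scale (ABSTRACT).**
For every odds constant `K ≥ 0` there are `λ > 0` and `n₀` such that every Dobrushin fibre system (`FibreSpread`'s
hypotheses: bounded tilt of a finite product probability space, conditional odds in `[e^{−K}, e^{K}]`, Dobrushin rows
`≤ 1/2`) on `n ≥ n₀` coordinates puts mass `≤ 1/8` on every window of the occupation number of length `D ≤ λ√n`.
Content: Dobrushin uniqueness with constant `≤ 1/4` (total-variation influence `≤ tanh(c/2) ≤ c/2`); the conditional
probability of OCC given everything else lies in `[e^{−K}/(1+e^{−K}), e^{K}/(1+e^{K})]`; martingale decomposition of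
`#occ` along the coordinates with total forward influence `≤ α/(1−α) ≤ 1/3`, hence `Var(#occ) ≥ e^{−K} n/9`; martingale
CLT with bounded increments and concentrated conditional variances (Dobrushin bounded differences), uniformly over the
class; a window of length `λ√n` then has mass `≤ 3λe^{K/2}/√(2π) + o(1) ≤ 1/8`.  (Dobrushin 1968; Künsch, CMP 84 (1982) 207;
Föllmer 1982; Külske 2003; Eichelsbacher–Löwe 2010 for the Stein route.) -/
theorem stub_dobrushinFibreSpread :
    ∀ K : ℝ, 0 ≤ K → ∃ lam : ℝ, 0 < lam ∧ ∃ n₀ : ℕ, ∀ (ι : Type) [Fintype ι] [DecidableEq ι],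
      n₀ ≤ Fintype.card ι → ∀ D : ℕ, (D : ℝ) ≤ lam * Real.sqrt (Fintype.card ι) → FibreSpread K ι D (1 / 8) := by
  sorry

/-- **S2 · `stub_frameReduction` — from fibrewise spread to the weighted window bound (ABSTRACT measure theory).**
Given a fibre witness for `(Ω, w·μ, X)` with parameters `(K, δ, N, n₁)` and ANY level `κ` such that every Dobrushin fibre
system on at least `n₁` coordinates is `κ`-spread at window length `D` (the shape S1 delivers), every window
`x ≤ X < x + J·D` carries `w·μ`-mass `≤ J (κ + 2δ) ∫ w ∂μ`.  Content: transport through `Φ`; discard `Bad` and the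
few-active event (`2δ`); Fubini for `ρ ⊗ π^{⊗N}` split along the (fibre-invariant) active set `A`, `|A| ≥ n₁`;
saturation makes each fibre `{frame, inactive interiors fixed} × ACT^A` good or bad as a whole; on a good fibre the
response clauses give `X ∘ Φ⁻¹ = X₀ + #occ` by refilling blocks one at a time through EMPTY (non-empty by
hypothesis); the pointwise odds / Dobrushin fields restrict to the fibre tilt (`MeasurableEquiv.piEquivPiSubtypeProd`);
apply the hypothesis at `x − X₀`; a window of length `J·D` is a union of `J` windows of length `D`. -/
theorem stub_frameReduction :
    ∀ {Ω : Type} [MeasurableSpace Ω] (μ : Measure Ω) (w : Ω → ℝ) (X : Ω → ℤ) (K δ : ℝ) (N n₁ : ℕ),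
      0 ≤ δ → (∀ ω, 0 ≤ w ω) → Measurable w → Integrable w μ → Measurable X →
      FibreWitness Ω μ w X K δ N n₁ →
      ∀ κ : ℝ, 0 ≤ κ → ∀ D : ℕ,
        (∀ (ι : Type) [Fintype ι] [DecidableEq ι], n₁ ≤ Fintype.card ι → FibreSpread K ι D κ) →
        ∀ (J : ℕ) (x : ℤ),
          ∫ ω in {ω | x ≤ X ω ∧ X ω < x + J * D}, w ω ∂μ ≤ (J * (κ + 2 * δ)) * ∫ ω, w ω ∂μ := by
  sorry

/-- **S3 · `stub_pinnedCleanEdge` — THE (E)-SIDE TRUNK: spectral-defect extinction with floor ONE along a slowly growing,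
physically deep line (`∃ reg`).**  For `N_f ∈ {2,3}` there is a mass-scaling, asymptotically scaling, polynomially capped,
branched regularisation of SLOW physical volume growth (`a_k(2L_k+1) ≤ a_k^{−1/2}` eventually — the witness's free choice, e.g.
`L_k = ⌈a_k⁻¹ n_k⌉` with `n_k ≤ a_k^{−1/2}/3`) and PHYSICAL DEPTH (`m_crit(k) ≤ −κ₀/β_k` eventually: the honest dressed edge is
`−m_crit ≈ 0.87/β_k` in tree units; this excludes the near-tip band by fiat), with `M₀ ≥ 0`, `c > 0` such that for every tuple
`m > M₀`: EXTINCT (verbatim) and TIGHT with floor ONE (`1 ≤ E₊|index|` at every probe `M > M₀`, eventually) — i.e. the body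
of the pre-restate crux (stmt-8964) plus cap, branch, slow growth and depth, WITHOUT the extensive floor R2.  This is strictly
on the EXTINCT side of the crux (conceded by every TIGHT⁺-side card; the object of corner-decorrelation / chessboard / kato /
krein-dressing and of the trunk of stmt-8967's split): a sharp real-mode accumulation edge at a physical depth, probed at `O(1)`
level.  Its TIGHT₁ half is within reach of the cards' ONE-LOOP lever (block odds `e^{−K}(log a_k⁻¹)^{−C}` × `N_k → ∞` blocks give
`E₊|index| → ∞ ≥ 1` for any growth `ℓ_k ≥ (log a_k⁻¹)^{C'}`); the amplification to the extensive floor is S4. -/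
theorem stub_pinnedCleanEdge :
    ∀ Nf : ℕ, (Nf = 2 ∨ Nf = 3) → ∃ reg : QCDRegularisation Nf, reg.HasMassScaling ∧
      (reg.scheme 0 0 0).HasAsymptoticScaling ∧
      (∃ p : ℕ, ∀ᶠ k : ℕ in Filter.atTop, (reg.L k : ℝ) ≤ (reg.a k)⁻¹ ^ p) ∧
      (∀ᶠ k : ℕ in Filter.atTop, -1 < reg.mcrit k) ∧
      (∀ᶠ k : ℕ in Filter.atTop, reg.a k * (2 * reg.L k + 1 : ℝ) ≤ Real.sqrt ((reg.a k)⁻¹)) ∧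
      (∃ κ₀ : ℝ, 0 < κ₀ ∧ ∀ᶠ k : ℕ in Filter.atTop, reg.mcrit k ≤ -κ₀ / reg.β k) ∧
      ∃ M₀ : ℝ, 0 ≤ M₀ ∧ ∃ c : ℝ, 0 < c ∧ ∀ m : Fin Nf → ℝ, (∀ f, M₀ < m f) →
        (∀ ε : ℝ, 0 < ε → ∀ᶠ k : ℕ in Filter.atTop, ∀ S : ℕ, reg.L k ≤ S → (∫ U, ((∑ f : Fin Nf, ((Multiset.countP (fun z : ℂ => z.im = 0 ∧ z.re < -(reg.mcrit k + reg.a k * m f / reg.Zm k)) (wilsonDirac (fundamentalRep (Fin 3)) U 0 1).charpoly.roots : ℝ) + (Multiset.countP (fun z : ℂ => |z.re| < c * (reg.a k * m f / reg.Zm k)) (spinorLift gammaFive * wilsonDirac (fundamentalRep (Fin 3)) U (reg.mcrit k + reg.a k * m f / reg.Zm k) 1).charpoly.roots : ℝ)))) * ∏ f : Fin Nf, ‖fermionDet (wilsonDirac (fundamentalRep (Fin 3)) U (reg.mcrit k + reg.a k * m f / reg.Zm k) 1)‖ ∂(wilsonMeasure (d := 4) (L := 2 * S + 1) (fundamentalRep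 (Fin 3)) (reg.β k))) / (∫ U, ∏ f : Fin Nf, ‖fermionDet (wilsonDirac (fundamentalRep (Fin 3)) U (reg.mcrit k + reg.a k * m f / reg.Zm k) 1)‖ ∂(wilsonMeasure (d := 4) (L := 2 * S + 1) (fundamentalRep (Fin 3)) (reg.β k))) ≤ ε * ((2 * S + 1 : ℝ) / (2 * reg.L k + 1)) ^ 4) ∧
        (∀ M : ℝ, M₀ < M → ∀ᶠ k : ℕ in Filter.atTop, (1 : ℝ) ≤ (∫ U, (|(Multiset.countP (fun z : ℂ => z.re < 0) (spinorLift gammaFive * wilsonDirac (fundamentalRep (Fin 3)) U (reg.mcrit k - reg.a k * M / reg.Zm k) 1).charpoly.roots : ℝ) - 6 * (2 * reg.L k + 1 : ℝ) ^ 4|) * ∏ f : Fin Nf, ‖fermionDet (wilsonDirac (fundamentalRep (Fin 3)) U (reg.mcrit k + reg.a k * m f / reg.Zm k) 1)‖ ∂(wilsonMeasure (d := 4) (L := 2 * reg.L k + 1) (fundamentalRep (Fin 3)) (reg.β k))) / (∫ U, ∏ f : Fin Nf, ‖fermionDet (wilsonDirac (fundamentalRep (Fin 3)) U (reg.mcrit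 k + reg.a k * m f / reg.Zm k) 1)‖ ∂(wilsonMeasure (d := 4) (L := 2 * reg.L k + 1) (fundamentalRep (Fin 3)) (reg.β k)))) := by
  sorry

/-- **S4 · `stub_uvFibreAmplification` — UV INSTANTON FIBRES AT EVERY PINNED CLEAN EDGE (the line's mechanism, `∀ reg`).**
For `N_f ∈ {2,3}`, EVERY mass-scaling, asymptotically scaling regularisation of slow growth and physical depth `κ₀ > 0` whose
line is EXTINCT-clean and TIGHT₁-pinned at a tuple `m > M₀` carries, at that tuple — provided the sea is HEAVY, `m > M₁(reg)`
(a threshold the mechanism chooses: `ρ₀ ≥ 1/M₁` keeps the sea transparent and (T-loc) in the perturbative heavy-quark regime) —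
UV instanton fibres with constants fixed BEFORE the probe: `∃ K ≥ 0, c₁ > 0, ∀ M > M₀, ∀ᶠ k`, the Wilson measure on the scheme torus `2L_k+1` at `β_k` with the
phase-quenched weight `w_k = ∏_f ‖det D_W(U, m_crit(k) + a_k m_f/Z_k, 1)‖` and the index
`X_k = n₋(Γ₅D_W(U, m_crit(k) − a_kM/Z_k, 1)) − 6(2L_k+1)⁴` admits a `FibreWitness` with bad/inactive level `δ = 1/32` and
`n₁ ≥ c₁ (a_k(2L_k+1))⁴` active blocks.  Physical content (card §Stubs T-dom / T-loc / T-resp / T-act): blocks of physical pitch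
`P(m)` framed by corridors; `Φ` = re-indexing of links, `ρ ⊗ π^{⊗N}` = product Haar, `W = e^{−β_k S_W}·w_k ∘ Φ⁻¹` (range-one action
⇒ frame-conditional independence is EXACT for the gauge part); OCC / EMPTY = small-field interiors with / without one
recognisable instanton of physical size `ρ₀` (`1/M₁ ≤ ρ₀ ≪ 1/Λ`) and a `t_k`-clean local spectrum at the probe; conditional odds
`e^{−K(ρ₀Λ, mρ₀)}` UNIFORMLY in `k` by a two-loop-matched gauge-covariant transport (Jensen in conditional mean; one loop leaves
`+3.97|3.56·log log a_k⁻¹` in `K`); Dobrushin rows from heavy-sea-quark locality of `log|det|` at physical pitch (renormalised-mass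
rate); response `+1` by the chiral real mode of the inserted instanton at the dressed edge `+ c a_k²/ρ₀² ≪ a_kM/Z_k` (TIGHT₁ ∧
EXTINCT pin the line to within `a_kM₀/Z_k` of that edge), cocycle locality (p104175) and near-probe sparsity (crossers at the
probe have physical size `√(c a_kZ_k/M) → 0`, density `∝ (a_kZ_k)^{(b−4)/2}` per block; slow growth closes the union bound);
activity by small-field typicality at scale `ρ₀` (Markov). -/
theorem stub_uvFibreAmplification :
    ∀ Nf : ℕ, (Nf = 2 ∨ Nf = 3) → ∀ reg : QCDRegularisation Nf, reg.HasMassScaling →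
      (reg.scheme 0 0 0).HasAsymptoticScaling →
      (∀ᶠ k : ℕ in Filter.atTop, reg.a k * (2 * reg.L k + 1 : ℝ) ≤ Real.sqrt ((reg.a k)⁻¹)) →
      ∀ κ₀ : ℝ, 0 < κ₀ → (∀ᶠ k : ℕ in Filter.atTop, reg.mcrit k ≤ -κ₀ / reg.β k) →
      ∃ M₁ : ℝ, 0 ≤ M₁ ∧ ∀ M₀ : ℝ, 0 ≤ M₀ → ∀ c : ℝ, 0 < c → ∀ m : Fin Nf → ℝ, (∀ f, M₀ < m f) → (∀ f, M₁ < m f) →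
        (∀ ε : ℝ, 0 < ε → ∀ᶠ k : ℕ in Filter.atTop, ∀ S : ℕ, reg.L k ≤ S → (∫ U, ((∑ f : Fin Nf, ((Multiset.countP (fun z : ℂ => z.im = 0 ∧ z.re < -(reg.mcrit k + reg.a k * m f / reg.Zm k)) (wilsonDirac (fundamentalRep (Fin 3)) U 0 1).charpoly.roots : ℝ) + (Multiset.countP (fun z : ℂ => |z.re| < c * (reg.a k * m f / reg.Zm k)) (spinorLift gammaFive * wilsonDirac (fundamentalRep (Fin 3)) U (reg.mcrit k + reg.a k * m f / reg.Zm k) 1).charpoly.roots : ℝ)))) * ∏ f : Fin Nf, ‖fermionDet (wilsonDirac (fundamentalRep (Fin 3)) U (reg.mcrit k + reg.a k * m f / reg.Zm k) 1)‖ ∂(wilsonMeasure (d := 4) (L := 2 * S + 1) (fundamentalRep (Fin 3)) (reg.β k))) / (∫ U, ∏ f : Fin Nf, ‖fermionDet (wilsonDirac (fundamentalRep (Fin 3)) U (reg.mcrit k + reg.a k * m f / reg.Zm k) 1)‖ ∂(wilsonMeasure (d := 4) (L := 2 * S + 1) (fundamentalRep (Fin 3)) (reg.β k))) ≤ ε *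 ((2 * S + 1 : ℝ) / (2 * reg.L k + 1)) ^ 4) →
        (∀ M : ℝ, M₀ < M → ∀ᶠ k : ℕ in Filter.atTop, (1 : ℝ) ≤ (∫ U, (|(Multiset.countP (fun z : ℂ => z.re < 0) (spinorLift gammaFive * wilsonDirac (fundamentalRep (Fin 3)) U (reg.mcrit k - reg.a k * M / reg.Zm k) 1).charpoly.roots : ℝ) - 6 * (2 * reg.L k + 1 : ℝ) ^ 4|) * ∏ f : Fin Nf, ‖fermionDet (wilsonDirac (fundamentalRep (Fin 3)) U (reg.mcrit k + reg.a k * m f / reg.Zm k) 1)‖ ∂(wilsonMeasure (d := 4) (L := 2 * reg.L k + 1) (fundamentalRep (Fin 3)) (reg.β k))) / (∫ U, ∏ f : Fin Nf, ‖fermionDet (wilsonDirac (fundamentalRep (Fin 3)) U (reg.mcrit k + reg.a k * m f / reg.Zm k) 1)‖ ∂(wilsonMeasure (d := 4) (L := 2 * reg.L k + 1) (fundamentalRep (Fin 3)) (reg.β k)))) →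
        ∃ K : ℝ, 0 ≤ K ∧ ∃ c₁ : ℝ, 0 < c₁ ∧ ∀ M : ℝ, M₀ < M → ∀ᶠ k : ℕ in Filter.atTop,
          ∃ N n₁ : ℕ, c₁ * (reg.a k * (2 * reg.L k + 1 : ℝ)) ^ 4 ≤ n₁ ∧
            Nonempty (FibreWitness (GaugeConfig 4 (2 * reg.L k + 1) SU3)
              (wilsonMeasure (d := 4) (L := 2 * reg.L k + 1) (fundamentalRep (Fin 3)) (reg.β k))
              (fun U => ∏ f : Fin Nf, ‖fermionDet (wilsonDirac (fundamentalRep (Fin 3)) U (reg.mcrit k + reg.a k * m f / reg.Zm k) 1)‖)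
              (fun U => ((Multiset.countP (fun z : ℂ => z.re < 0) (spinorLift gammaFive * wilsonDirac (fundamentalRep (Fin 3)) U (reg.mcrit k - reg.a k * M / reg.Zm k) 1).charpoly.roots : ℕ) : ℤ) - 6 * (2 * (reg.L k : ℤ) + 1) ^ 4)
              K (1 / 32) N n₁) := by
  sorry

/-! ## §C  Composition -/

/-- The physical side `a_k (2L_k+1)` tends to `∞` along any regularisation (`a_k L_k → ∞`, `a_k > 0`). -/
theorem tendsto_side {Nf : ℕ} (reg : QCDRegularisation Nf) :
    Tendsto (fun k => reg.a k * (2 * reg.L k + 1 : ℝ)) atTop atTop := by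
  refine tendsto_atTop_mono (fun k => ?_) reg.tendsto_L
  have ha := (reg.a_pos k).le
  have hL : (reg.L k : ℝ) ≤ 2 * reg.L k + 1 := by
    have : (0 : ℝ) ≤ reg.L k := Nat.cast_nonneg _
    linarith
  exact mul_le_mul_of_nonneg_left hL ha

set_option maxHeartbeats 400000 in
/-- **The composition: S1 + S2 + S3 + S4 (+ landed `stub_windowToMoment`, `stub_indexMeasurable`) ⇒ the crux
`WindowExtinction` (SD⁺).**  EXTINCT, the scalings, the cap and the branch clause come verbatim from S3; S4 turns S3's
EXTINCT ∧ TIGHT₁ at the tuple `m` into UV fibres; TIGHT⁺ with `η = (13/64)·λ(K)·√c₁` (`K, c₁` fixed by S4 before the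
probe, `λ` by S1): at probe `M`, eventually in `k`, the fibre
witness of S3 has `n₁ ≥ c₁ ℓ_k⁴ ≥ n₀(K)` active blocks; with `D = ⌊λ√n₁⌋ ≥ λ√c₁ ℓ_k² − 1`, S2 at `κ = 1/8` (fibres spread
by S1) bounds every window of length `D` by `3/16` of the mass, and `stub_windowToMoment` (`J = 1`) gives
`E₊|X_k| ≥ (13/16)(D/2 − 1) ≥ η ℓ_k²` once `λ√c₁ ℓ_k² ≥ 6`. -/
theorem WindowExtinction_of : WindowExtinction := by
  intro Nf hNf
  obtain ⟨reg, hMS, hAS, hCap, hBr, hSlow, ⟨κ₀, hκ₀, hDepth⟩, M₀, hM₀, c, hc, H⟩ := stub_pinnedCleanEdge Nf hNf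
  obtain ⟨M₁, hM₁, Hamp⟩ := stub_uvFibreAmplification Nf hNf reg hMS hAS hSlow κ₀ hκ₀ hDepth
  -- the crux's threshold is raised to `max M₀ M₁` (heavy sea for S4; EXTINCT and TIGHT₁ from S3 above `M₀`)
  refine ⟨reg, hMS, hAS, hCap, hBr, max M₀ M₁, le_max_of_le_left hM₀, c, hc, fun m hm => ?_⟩
  have hm₀ : ∀ f, M₀ < m f := fun f => (le_max_left _ _).trans_lt (hm f)
  have hm₁ : ∀ f, M₁ < m f := fun f => (le_max_right _ _).trans_lt (hm f)
  refine ⟨(H m hm₀).1, ?_⟩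
  obtain ⟨K, hK, c₁, hc₁, Hfib⟩ := Hamp M₀ hM₀ c hc m hm₀ hm₁ (H m hm₀).1 (H m hm₀).2
  obtain ⟨lam, hlam, n₀, hS1⟩ := stub_dobrushinFibreSpread K hK
  -- the TIGHT⁺ constant, fixed before the probe
  set η : ℝ := 13 / 64 * lam * Real.sqrt c₁ with hη
  have hsc₁ : 0 < Real.sqrt c₁ := Real.sqrt_pos.2 hc₁
  have hηpos : 0 < η := by positivity
  refine ⟨η, hηpos, fun M hM => ?_⟩
  have hM' : M₀ < M := (le_max_left _ _).trans_lt hM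
  -- threshold on the physical side `ℓ_k = a_k(2L_k+1)`
  set T : ℝ := max 1 (max ((n₀ : ℝ) / c₁ + 1) (6 / (lam * Real.sqrt c₁))) with hT
  have hside := (tendsto_side reg).eventually_ge_atTop T
  filter_upwards [Hfib M hM', hside] with k hk hks
  obtain ⟨N, n₁, hn₁, ⟨dW⟩⟩ := hk
  -- abbreviations
  set μ := wilsonMeasure (d := 4) (L := 2 * reg.L k + 1) (fundamentalRep (Fin 3)) (reg.β k) with hμ
  set w : GaugeConfig 4 (2 * reg.L k + 1) SU3 → ℝ :=
    fun U => ∏ f : Fin Nf, ‖fermionDet (wilsonDirac (fundamentalRep (Fin 3)) U (reg.mcrit k + reg.a k * m f / reg.Zm k) 1)‖ with hw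
  set X : GaugeConfig 4 (2 * reg.L k + 1) SU3 → ℤ :=
    fun U => ((Multiset.countP (fun z : ℂ => z.re < 0) (spinorLift gammaFive * wilsonDirac (fundamentalRep (Fin 3)) U (reg.mcrit k - reg.a k * M / reg.Zm k) 1).charpoly.roots : ℕ) : ℤ) - 6 * (2 * (reg.L k : ℤ) + 1) ^ 4 with hX
  set ℓ : ℝ := reg.a k * (2 * reg.L k + 1 : ℝ) with hℓ
  set Z : ℝ := ∫ U, w U ∂μ with hZdef
  -- unpacking the threshold
  have hℓ1 : 1 ≤ ℓ := le_trans (le_max_left _ _) hks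
  have hℓ0 : 0 ≤ ℓ := zero_le_one.trans hℓ1
  have hℓn₀ : (n₀ : ℝ) / c₁ + 1 ≤ ℓ := le_trans (le_trans (le_max_left _ _) (le_max_right _ _)) hks
  have hℓ6 : 6 / (lam * Real.sqrt c₁) ≤ ℓ := le_trans (le_trans (le_max_right _ _) (le_max_right _ _)) hks
  have hℓsq : ℓ ≤ ℓ ^ 2 := by nlinarith
  have hℓ4 : ℓ ≤ ℓ ^ 4 := by nlinarith
  -- regularity of the weight and of the index (Literature `QCDPhaseQuenched` + S7)
  have hw0 : ∀ U, 0 ≤ w U := fun U => Finset.prod_nonneg fun f _ => norm_nonneg _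
  have hweq : w = fun U => ‖(diracMatrix U (fun f : Fin Nf => reg.mcrit k + reg.a k * m f / reg.Zm k)).det‖ := by
    funext U
    simp only [hw, norm_det_diracMatrix]
  have hwmeas : Measurable w := by
    rw [hweq]
    exact measurable_norm_det_diracMatrix _
  have hZ : 0 < Z := by
    have h := integral_norm_det_diracMatrix_pos_all (S := 2 * reg.L k + 1) (reg.β k)
      (fun f : Fin Nf => reg.mcrit k + reg.a k * m f / reg.Zm k)
    refine h.trans_eq (integral_congr_ae (Eventually.of_forall fun U => ?_))
    simp only [hw, norm_det_diracMatrix]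
  have hwint : Integrable w μ := by
    have h := integrable_norm_det_diracMatrix (S := 2 * reg.L k + 1)
      (fun f : Fin Nf => reg.mcrit k + reg.a k * m f / reg.Zm k) μ
    refine h.congr (Eventually.of_forall fun U => ?_)
    simp only [hw, norm_det_diracMatrix]
  have hXmeas : Measurable X := by
    have h := stub_indexMeasurable (2 * reg.L k + 1) (reg.mcrit k - reg.a k * M / reg.Zm k)
    exact (measurable_from_top (f := fun n : ℕ => (n : ℤ) - 6 * (2 * (reg.L k : ℤ) + 1) ^ 4)).comp h
  have hXbound : ∀ U, |(X U : ℝ)| ≤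
      (Fintype.card (TorusSite 4 (2 * reg.L k + 1) × Fin 3 × Fin 4) : ℝ) + 6 * (2 * (reg.L k : ℝ) + 1) ^ 4 := by
    intro U
    set A := spinorLift gammaFive * wilsonDirac (fundamentalRep (Fin 3)) U (reg.mcrit k - reg.a k * M / reg.Zm k) 1
      with hA
    have h1 : Multiset.countP (fun z : ℂ => z.re < 0) A.charpoly.roots ≤
        Fintype.card (TorusSite 4 (2 * reg.L k + 1) × Fin 3 × Fin 4) :=
      calc Multiset.countP (fun z : ℂ => z.re < 0) A.charpoly.roots
          ≤ Multiset.card A.charpoly.roots := Multiset.countP_le_card _ _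
        _ ≤ A.charpoly.natDegree := Polynomial.card_roots' _
        _ = Fintype.card (TorusSite 4 (2 * reg.L k + 1) × Fin 3 × Fin 4) := Matrix.charpoly_natDegree_eq_dim _
    have h1' : ((Multiset.countP (fun z : ℂ => z.re < 0) A.charpoly.roots : ℕ) : ℝ) ≤
        Fintype.card (TorusSite 4 (2 * reg.L k + 1) × Fin 3 × Fin 4) := by exact_mod_cast h1
    have h0 : (0 : ℝ) ≤ (Multiset.countP (fun z : ℂ => z.re < 0) A.charpoly.roots : ℕ) := Nat.cast_nonneg _
    have h6 : (0 : ℝ) ≤ 6 * (2 * (reg.L k : ℝ) + 1) ^ 4 := by positivity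
    simp only [hX]
    push_cast
    rw [abs_le]
    constructor <;> linarith
  have hXwint : Integrable (fun U => |(X U : ℝ)| * w U) μ := by
    have hXr : Measurable fun U => |(X U : ℝ)| :=
      (measurable_from_top (f := fun n : ℤ => |(n : ℝ)|)).comp hXmeas
    refine (hwint.const_mul ((Fintype.card (TorusSite 4 (2 * reg.L k + 1) × Fin 3 × Fin 4) : ℝ) +
      6 * (2 * (reg.L k : ℝ) + 1) ^ 4)).mono' (hXr.aestronglyMeasurable.mul hwint.aestronglyMeasurable) ?_
    exact Eventually.of_forall fun U => by
      rw [Real.norm_eq_abs, abs_mul, abs_abs, abs_of_nonneg (hw0 U)]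
      exact mul_le_mul_of_nonneg_right (hXbound U) (hw0 U)
  -- `n₁ ≥ n₀` and `√n₁ ≥ √c₁ ℓ²`
  have hn₁ℓ : c₁ * ℓ ^ 4 ≤ (n₁ : ℝ) := hn₁
  have hn₀n₁ : n₀ ≤ n₁ := by
    have h1 : (n₀ : ℝ) / c₁ ≤ ℓ ^ 4 := by linarith
    have h2 : (n₀ : ℝ) ≤ c₁ * ℓ ^ 4 := by
      rw [div_le_iff₀ hc₁] at h1
      linarith
    exact_mod_cast h2.trans hn₁ℓ
  have hsqrt : Real.sqrt c₁ * ℓ ^ 2 ≤ Real.sqrt n₁ := by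
    have h1 : Real.sqrt (c₁ * ℓ ^ 4) ≤ Real.sqrt n₁ := Real.sqrt_le_sqrt hn₁ℓ
    have h2 : Real.sqrt (c₁ * ℓ ^ 4) = Real.sqrt c₁ * ℓ ^ 2 := by
      rw [Real.sqrt_mul hc₁.le, show ℓ ^ 4 = (ℓ ^ 2) ^ 2 by ring, Real.sqrt_sq (by positivity)]
    rw [← h2]
    exact h1
  -- the window length
  set D : ℕ := ⌊lam * Real.sqrt n₁⌋₊ with hD
  have hDle : (D : ℝ) ≤ lam * Real.sqrt n₁ := Nat.floor_le (by positivity)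
  have hDge : lam * Real.sqrt n₁ - 1 ≤ (D : ℝ) := (Nat.sub_one_lt_floor _).le
  have hlamℓ : 6 ≤ lam * Real.sqrt c₁ * ℓ := by
    rw [div_le_iff₀ (by positivity)] at hℓ6
    linarith
  have hlamℓ2 : 6 ≤ lam * Real.sqrt c₁ * ℓ ^ 2 := by
    have := mul_le_mul_of_nonneg_left hℓsq (show 0 ≤ lam * Real.sqrt c₁ by positivity)
    linarith
  have hDge' : lam * Real.sqrt c₁ * ℓ ^ 2 - 1 ≤ (D : ℝ) := by
    have := mul_le_mul_of_nonneg_left hsqrt hlam.le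
    linarith
  have hDpos : 0 < D := by
    have : (0 : ℝ) < D := by linarith
    exact_mod_cast this
  -- S1 ⇒ the fibrewise hypothesis of S2 at level `1/8`
  have hschema : ∀ (ι : Type) [Fintype ι] [DecidableEq ι], n₁ ≤ Fintype.card ι → FibreSpread K ι D (1 / 8) := by
    intro ι _ _ hι
    refine hS1 ι (hn₀n₁.trans hι) D (hDle.trans ?_)
    have : Real.sqrt n₁ ≤ Real.sqrt (Fintype.card ι) := Real.sqrt_le_sqrt (by exact_mod_cast hι)
    exact mul_le_mul_of_nonneg_left this hlam.le
  -- S2: every window of length `D` has PQ-mass `≤ 3/16`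
  have hwin := stub_frameReduction μ w X K (1 / 32) N n₁ (by norm_num) hw0 hwmeas hwint hXmeas dW (1 / 8)
    (by norm_num) D hschema 1
  have hwin' : ∀ x : ℤ, ∫ U in {U | x ≤ X U ∧ X U < x + (1 : ℕ) * D}, w U ∂μ ≤ ((0 : ℝ) + (1 : ℕ) * (3 / 16)) * Z := by
    intro x
    refine (hwin x).trans (le_of_eq ?_)
    simp only [hZdef]
    norm_num
  -- `stub_windowToMoment` with `J = 1`, `κ = 3/16`, `δ = 0`
  have hmom := stub_windowToMoment μ w X D 1 (3 / 16) 0 hDpos (by norm_num) le_rfl (by norm_num) hw0 hXmeas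
    hwint hXwint hwin'
  -- arithmetic: `(13/16)(D/2 − 1) ≥ η ℓ²` (linear in `A := λ √c₁ ℓ²` and `D`)
  have hA : η * ℓ ^ 2 = 13 / 64 * (lam * Real.sqrt c₁ * ℓ ^ 2) := by
    simp only [hη]; ring
  set A : ℝ := lam * Real.sqrt c₁ * ℓ ^ 2 with hAdef
  have hfloor : η * ℓ ^ 2 * Z ≤ ∫ U, |(X U : ℝ)| * w U ∂μ := by
    have hZ0 : 0 ≤ Z := hZ.le
    have h1 : η * ℓ ^ 2 ≤ (((1 : ℕ) * D : ℝ) / 2 - 1) * (1 - 0 - (1 : ℕ) * (3 / 16 : ℝ)) := by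
      have hR : (((1 : ℕ) * D : ℝ) / 2 - 1) * (1 - 0 - (1 : ℕ) * (3 / 16 : ℝ)) = 13 / 32 * (D : ℝ) - 13 / 16 := by
        simp only [Nat.cast_one, one_mul]; ring
      rw [hA, hR]
      linarith [hDge', hlamℓ2]
    exact (mul_le_mul_of_nonneg_right h1 hZ0).trans hmom
  -- `max 1 (η ℓ²) = η ℓ²` for large `k`
  have hηℓ : 1 ≤ η * ℓ ^ 2 := by
    rw [hA]
    linarith [hlamℓ2]
  rw [max_eq_right hηℓ, le_div_iff₀ hZ]
  -- identify the integrand of the route file with `|X| * w`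
  have hint : ∫ U, |(X U : ℝ)| * w U ∂μ =
      ∫ U, (|(Multiset.countP (fun z : ℂ => z.re < 0) (spinorLift gammaFive * wilsonDirac (fundamentalRep (Fin 3)) U (reg.mcrit k - reg.a k * M / reg.Zm k) 1).charpoly.roots : ℝ) - 6 * (2 * reg.L k + 1 : ℝ) ^ 4|) * ∏ f : Fin Nf, ‖fermionDet (wilsonDirac (fundamentalRep (Fin 3)) U (reg.mcrit k + reg.a k * m f / reg.Zm k) 1)‖ ∂μ := by
    refine integral_congr_ae (Eventually.of_forall fun U => ?_)
    simp only [hX, hw]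
    push_cast
    ring_nf
  rw [← hint]
  exact hfloor

end Summit.QuantumFields.QCD.Cruxes.WindowExtinction.UVInstantonFloor

end
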